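import Literature.NumberTheory.Transcendental.DiazCor1Proofs
import Literature.NumberTheory.Transcendental.NesterenkoEliminationProp411Holds
import HarnessLib

/-!
# Discharges of named facts of `DiazMain.lean`

`Literature/NumberTheory/Transcendental/DiazMainHolds.lean` — proofs-only sibling of
`DiazMain.lean` (no definitions, no named facts). Each theorem below closes a named fact `X :
Prop` of that file as `X_holds : X` by composing an ACCEPTED reduction theorem of the tree
with the ACCEPTED unconditional `_holds` discharges of all of its hypotheses; nothing is
re-proved and no statement is changed. Recorded by the librarian sweep g25 (2026-08-16, pass
5c: facts dischargeable in one line from the tree's own lemmas), so that the facts census,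
`#h21_route_deps` and the cone guardrail see these facts as theorems.

Discharged here:

* `Diaz1989_thm1_holds` := `Diaz1989_thm1_of_prop_4_11`
  `NesterenkoPhilippon2001_ch3_prop_4_11_holds` (`DiazCor1Proofs.lean`).
* `Diaz1989_cor1_holds` := `Diaz1989_cor1_of_prop_4_11`
  `NesterenkoPhilippon2001_ch3_prop_4_11_holds` (`DiazCor1Proofs.lean`).

## References

* [Diaz1989] — see `lean/references.bib` and the docstring of the fact in `DiazMain.lean`.
-/

namespace Literature.NumberTheory.Transcendental

/-- **Discharge of the named fact `Diaz1989_thm1`** (`DiazMain.lean`): Diaz 1989, Théorème 1 (the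
theorem behind the Gelfond–Diaz ladder): let `u₁,…,u_n` and `v₁,…,v_m` be two families of
complex numbers, each `ℚ`-linearly independent, satisfying (HT1): … — obtained as
`Diaz1989_thm1_of_prop_4_11` applied to the tree's unconditional discharge
`NesterenkoPhilippon2001_ch3_prop_4_11_holds` of its hypothesis (reduction in
`DiazCor1Proofs.lean`).
[cite: Diaz1989, Théorème 1, pp. 1–2] -/
theorem Diaz1989_thm1_holds :
    Diaz1989_thm1 :=
  Diaz1989_thm1_of_prop_4_11
    Literature.NumberTheory.Transcendental.Nesterenko.NesterenkoPhilippon2001_ch3_prop_4_11_holds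

/-- **Discharge of the named fact `Diaz1989_cor1`** (`DiazMain.lean`): Diaz 1989, Corollaire 1
(the ladder for an arbitrary base): let `a ∈ ℂ` be non-zero with a non-zero logarithm `l`
(`e^l = a`, `l ≠ 0`), and `β` algebraic of degree `d ≥ 2`. … — obtained as
`Diaz1989_cor1_of_prop_4_11` applied to the tree's unconditional discharge
`NesterenkoPhilippon2001_ch3_prop_4_11_holds` of its hypothesis (reduction in
`DiazCor1Proofs.lean`).
[cite: Diaz1989, Corollaire 1, p. 3] -/
theorem Diaz1989_cor1_holds :
    Diaz1989_cor1 :=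
  Diaz1989_cor1_of_prop_4_11
    Literature.NumberTheory.Transcendental.Nesterenko.NesterenkoPhilippon2001_ch3_prop_4_11_holds

end Literature.NumberTheory.Transcendental
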